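/-
Copyright (c) 2026. All rights reserved.
Released under Apache 2.0 license as described in the file LICENSE.
-/
import Mathlib
import HarnessLib
import Literature.MathematicalPhysics.QuantumLattice.AbelianFieldTensor
import Literature.MathematicalPhysics.QuantumLattice.AbelianMagneticFlux
import Literature.MathematicalPhysics.QuantumFieldTheory.U1WardIdentity
import Summits.Ventures.LatticeQCDFlow.Scaling.FluxSectorCollar
import Summits.Ventures.LatticeQCDFlow.Scaling.SliceTwistWitness
import Summits.Ventures.LatticeQCDFlow.Scaling.FluxInsertionKernel
import Summits.Ventures.LatticeQCDFlow.Scaling.FluxInsertionLine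
import Summits.Ventures.LatticeQCDFlow.Scaling.FluxInsertionSharpFloorInstances
import Summits.Ventures.LatticeQCDFlow.Scaling.FluxInsertionHeightLaw
import Summits.Ventures.LatticeQCDFlow.Scaling.TorusPotential
import Summits.Ventures.LatticeQCDFlow.Scaling.FluxInsertionHeightCeiling
import Summits.Ventures.LatticeQCDFlow.Scaling.SectorActionFloor
import Summits.Ventures.LatticeQCDFlow.Scaling.FluxInsertionMountainPass
import Summits.Ventures.LatticeQCDFlow.Scaling.FluxInsertionHeightValue
import Summits.Ventures.LatticeQCDFlow.Scaling.FluxInsertionLineHeightValue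
import Summits.Ventures.LatticeQCDFlow.Scaling.FluxInsertionMountainPassFour

/-!
# The LINE flux-insertion kernel at EVERY volume `L ≥ 4`: the sharp fixed-volume rate is
`L(1 − cos(π/L)) + (L² − L)(1 − cos(π/(L² − L)))` — conjecture C9″c as stated (lean-1 GEN-7, own work)

HONEST FRAMING: exact (Metropolis-corrected) sampling algorithms for lattice gauge theory;
figures of merit are autocorrelation/cost numbers at stated couplings and volumes; no
continuum-physics claim.

Venture `LatticeQCDFlow` (cell pub-lqcd), topic `Scaling`, FANOUT row 30 (lean-1).  NEW WORK of the
cell; nothing here is cited as a fact; no `def`.  `d = 2`, compact `U(1)`, torus `(ℤ/L)²`, gen-19's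
two-sided Metropolis LINE-insertion kernel `K_line = insertionMH (sliceTwist L) e^{−βS}` (item 99),
its essential min–max height `H_line(L) = insHeight₂ (sliceTwist L) 0 0 1` (item 106b) and
`E*_line(L) = L(1 − cos(π/L)) + (L² − L)(1 − cos(π/(L² − L)))`.

`Scaling/FluxInsertionLineHeightValue` (lean-1 GEN-6) proved `H_line(L) = E*_line(L)` and the
fixed-volume sharp rate for every `L ≥ 5`; conjecture C9″c of the cell's THEORY-2.md §4 (v4.0) says
"every `L ≥ 4`".  The missing volume `L = 4` has `N = 4` touched plaquettes (contact angle
`α/2 = π/4`) and `M = 12` untouched ones, which is exactly the new case of the `N ≥ 4` mountain pass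
`sharpValue_le_max_wilsonAction_of_exp_four` (`Scaling/FluxInsertionMountainPassFour`, via
theory2's whole-circle tangent line `Trig.cos_le_tangent` at contact `π/4`).  This file records:
* `lineSharpValue_le_max_wilsonAction_four` (`4 ≤ L`): for EVERY `U` with
  `Q((sliceTwist L)⁻¹ U) ≠ Q(U)`, `max(S(U), S((sliceTwist L)⁻¹ U)) ≥ E*_line(L)`;
* `lineHeight_le_sharp_ennreal_two` (`2 ≤ L`): the ceiling `H_line(L) ≤ E*_line(L)` by the line's
  half-way configuration holds at EVERY volume `L ≥ 2` (all its plaquette angles are `≤ π/2`);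
  `lineHeight_ne_top_two`;
* `lineHeight_eq_sharp_four`: **`H_line(L) = E*_line(L)` for every `L ≥ 4`** (every parity);
  `lineHeight_le_pi_sq_div_four`: `H_line(L) ≤ π²/L`;
* `u1_lineInsertion_fixedVolume_rate_four`: for every `L ≥ 4` and `ε > 0`, eventually in `β`,
  `e^{−β(E*_line + ε)} ≤ (μ_β ⊗ K_line){Q ≠ Q'} ≤ e^{−β(E*_line − ε)}` — C9″c exactly as conjectured.
`L = 3` (`N = 3`, contact `π/3 > π/4`, where the whole-circle tangent bound fails) is NOT claimed.
No `def`, no `sorry`, standard axioms only.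
-/

noncomputable section

open MeasureTheory ProbabilityTheory Filter Topology Real Set
open scoped ENNReal
open Literature.MathematicalPhysics.QuantumFieldTheory Literature.MathematicalPhysics.QuantumLattice
open Summit.Ventures.LatticeQCDFlow.Exactness

namespace Summit.Ventures.LatticeQCDFlow.Theory2.Lattice.Flux

variable {L : ℕ} [NeZero L]

/-! ## §1 The floor at `L ≥ 4` -/

section LineFloor

/-- **THE MOUNTAIN-PASS INEQUALITY FOR THE LINE, `4 ≤ L`**: for EVERY configuration `U` whose
charge is changed by the inverse slice twist, `max(S(U), S((sliceTwist L)⁻¹ U)) ≥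
L(1 − cos(π/L)) + (L² − L)(1 − cos(π/(L² − L)))` (`N = L ≥ 4`, `M = L² − L ≥ 12`). [folklore] -/
theorem lineSharpValue_le_max_wilsonAction_four (hL : 4 ≤ L) (U : GaugeConfig 2 L Circle)
    (hne : topCharge (0 : Site 2 L) 0 1 ((sliceTwist L)⁻¹ * U) ≠ topCharge (0 : Site 2 L) 0 1 U) :
    (L : ℝ) * (1 - Real.cos (π / L)) +
        ((L : ℝ) ^ 2 - L) * (1 - Real.cos (π / ((L : ℝ) ^ 2 - L))) ≤
      max (wilsonAction u1Rep U) (wilsonAction u1Rep ((sliceTwist L)⁻¹ * U)) := by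
  have hL' : (4 : ℝ) ≤ L := by exact_mod_cast hL
  have hcard : ((lineSites L).card : ℝ) = L := by rw [card_lineSites]
  have hN4 : 4 ≤ (lineSites L).card := by rw [card_lineSites]; exact hL
  have hNM : (lineSites L).card ≤ (lineSites L)ᶜ.card := by
    have : ((lineSites L).card : ℝ) ≤ (((lineSites L)ᶜ.card : ℕ) : ℝ) := by
      rw [hcard, card_compl_lineSites]; nlinarith
    exact_mod_cast this
  have hM7 : 7 ≤ (lineSites L)ᶜ.card := by
    have : (7 : ℝ) ≤ (((lineSites L)ᶜ.card : ℕ) : ℝ) := by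
      rw [card_compl_lineSites]; nlinarith
    exact_mod_cast this
  have hNα : ((lineSites L).card : ℝ) * (2 * π / L) = 2 * π := by
    rw [hcard]; field_simp
  have h := sharpValue_le_max_wilsonAction_of_exp_four (sliceTwist L)⁻¹ U (lineSites L)
    (plaquetteHolonomy_sliceTwist_inv_ite) (by positivity) hNα hN4 hNM (Or.inr hM7) hne
  rw [hcard, card_compl_lineSites, show 2 * π / (L : ℝ) / 2 = π / L by ring] at h
  exact h

end LineFloor

/-! ## §2 The ceiling at every volume `L ≥ 2` -/

section LineWitness

omit [NeZero L] in
/-- Bounds: all half-way angles, before and after the insertion, lie in `[−π/2, π/2]` as soon as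
`2 ≤ L`. [folklore] -/
theorem lineHalfTable_bounds_two (hL : 2 ≤ L) (a : ℕ) :
    |(if a = 0 then -(π / L) else π / ((L : ℝ) ^ 2 - L))| ≤ π / 2 ∧
      |(if a = 0 then π / (L : ℝ) else π / ((L : ℝ) ^ 2 - L))| ≤ π / 2 := by
  have hL' : (2 : ℝ) ≤ L := by exact_mod_cast hL
  have h1 : π / (L : ℝ) ≤ π / 2 := div_le_div_of_nonneg_left Real.pi_pos.le (by norm_num) hL'
  have h2 : π / ((L : ℝ) ^ 2 - L) ≤ π / 2 :=
    div_le_div_of_nonneg_left Real.pi_pos.le (by norm_num) (by nlinarith)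
  have h1' : 0 ≤ π / (L : ℝ) := by positivity
  have h2' : 0 ≤ π / ((L : ℝ) ^ 2 - L) := div_nonneg Real.pi_pos.le (by nlinarith)
  constructor <;> split_ifs <;> rw [abs_le] <;> constructor <;> linarith

/-- **THE CEILING FOR THE LINE AT EVERY VOLUME** (`2 ≤ L`): `insHeight (sliceTwist L)⁻¹ ≤ E*_line(L)`,
witnessed by the half-way configuration `potField(−π/L on the line, π/(L² − L) off it)`, whose
plaquette angles before and after the insertion are all at most `π/2` in size. [folklore] -/
theorem lineHeight_le_sharp_ennreal_two (hL : 2 ≤ L) :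
    insHeight₂ (sliceTwist L) (0 : Site 2 L) 0 1 ≤ ENNReal.ofReal
      ((L : ℝ) * (1 - Real.cos (π / L)) +
        ((L : ℝ) ^ 2 - L) * (1 - Real.cos (π / ((L : ℝ) ^ 2 - L)))) := by
  have hL1 : 1 < L := by omega
  set c : ℕ → ℕ → ℝ := fun a _ => if a = 0 then -(π / L) else π / ((L : ℝ) ^ 2 - L) with hc_def
  have hcs : ∑ a ∈ Finset.range L, ∑ b ∈ Finset.range L, c a b = 0 := by
    simp only [hc_def]; exact sum_lineHalfTable (by omega)
  set U₀ : GaugeConfig 2 L Circle := potField c with hU₀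
  have hP : ∀ x : Site 2 L, plaquetteHolonomy U₀ x 0 1 = Circle.exp (c (x 0).val (x 1).val) :=
    plaquetteHolonomy_potField hL1 hcs
  set c' : ℕ → ℕ → ℝ := fun a _ => if a = 0 then π / (L : ℝ) else π / ((L : ℝ) ^ 2 - L)
    with hc'_def
  have hPX : ∀ x : Site 2 L, plaquetteHolonomy ((sliceTwist L)⁻¹ * U₀) x 0 1 =
      Circle.exp (c' (x 0).val (x 1).val) := by
    intro x
    rw [plaquetteHolonomy_mul', plaquetteHolonomy_sliceTwist_inv_val, hP, ← Circle.exp_add]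
    simp only [hc_def, hc'_def, lineHalfTable_add]
  have hb : ∀ a b, |c a b| ≤ π / 2 ∧ |c' a b| ≤ π / 2 := fun a b => lineHalfTable_bounds_two hL a
  have hin : ∀ {t : ℝ}, |t| ≤ π / 2 → -π < t ∧ t < π := fun ht => by
    have := abs_le.mp ht; constructor <;> linarith [Real.pi_pos]
  have hFU : ∀ x : Site 2 L, abelianFieldTensor U₀ x 0 1 = c (x 0).val (x 1).val := fun x =>
    abelianFieldTensor_eq_of_plaquette_eq_exp (hP x) (hin (hb (x 0).val (x 1).val).1).1
      (hin (hb (x 0).val (x 1).val).1).2.le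
  have hFX : ∀ x : Site 2 L, abelianFieldTensor ((sliceTwist L)⁻¹ * U₀) x 0 1 =
      c' (x 0).val (x 1).val := fun x =>
    abelianFieldTensor_eq_of_plaquette_eq_exp (hPX x) (hin (hb (x 0).val (x 1).val).2).1
      (hin (hb (x 0).val (x 1).val).2).2.le
  have hL' : (2 : ℝ) ≤ L := by exact_mod_cast hL
  have hL0 : (L : ℝ) ≠ 0 := by positivity
  have hM0 : (L : ℝ) ^ 2 - L ≠ 0 := by nlinarith
  have hcs' : ∑ a ∈ Finset.range L, ∑ b ∈ Finset.range L, c' a b = 2 * π := by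
    simp only [hc'_def]
    have e1 : (L : ℝ) * (π / L) = π := by field_simp
    have e2 : ((L : ℝ) ^ 2 - L) * (π / ((L : ℝ) ^ 2 - L)) = π := mul_div_cancel₀ _ hM0
    rw [sum_lineTable (by omega), e1, e2]
    ring
  have hQU : topCharge (0 : Site 2 L) 0 1 U₀ = 0 := by
    rw [topCharge_of_fieldTensor hFU, hcs, zero_div]
  have hQX : topCharge (0 : Site 2 L) 0 1 ((sliceTwist L)⁻¹ * U₀) = 1 := by
    rw [topCharge_of_fieldTensor hFX, hcs']
    field_simp
  have hval : ∀ (g : ℕ → ℕ → ℝ), (∀ a b, g a b = if a = 0 then π / (L : ℝ) else π / ((L : ℝ) ^ 2 - L)) ∨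
      (∀ a b, g a b = if a = 0 then -(π / (L : ℝ)) else π / ((L : ℝ) ^ 2 - L)) →
      ∑ a ∈ Finset.range L, ∑ b ∈ Finset.range L, (1 - Real.cos (g a b)) =
        (L : ℝ) * (1 - Real.cos (π / L)) +
          ((L : ℝ) ^ 2 - L) * (1 - Real.cos (π / ((L : ℝ) ^ 2 - L))) := by
    intro g hg
    have e : ∀ a b, 1 - Real.cos (g a b) =
        if a = 0 then 1 - Real.cos (π / L) else 1 - Real.cos (π / ((L : ℝ) ^ 2 - L)) := by
      intro a b
      rcases hg with hg | hg <;> rw [hg] <;> split_ifs <;> simp [Real.cos_neg]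
    simp only [e]
    exact sum_lineTable (by omega) _ _
  have hSU : wilsonAction u1Rep U₀ = (L : ℝ) * (1 - Real.cos (π / L)) +
      ((L : ℝ) ^ 2 - L) * (1 - Real.cos (π / ((L : ℝ) ^ 2 - L))) := by
    rw [wilsonAction_of_plaquette_exp hP]
    exact hval c (Or.inr fun a b => rfl)
  have hSX : wilsonAction u1Rep ((sliceTwist L)⁻¹ * U₀) = (L : ℝ) * (1 - Real.cos (π / L)) +
      ((L : ℝ) ^ 2 - L) * (1 - Real.cos (π / ((L : ℝ) ^ 2 - L))) := by
    rw [wilsonAction_of_plaquette_exp hPX]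
    exact hval c' (Or.inl fun a b => rfl)
  have h1 := insHeight_le_of_witness (sliceTwist L)⁻¹ U₀ (0 : Site 2 L) 0 1
    (fun x => by
      rw [hP]
      exact coe_circleExp_mem_slitPlane (hin (hb (x 0).val (x 1).val).1).1
        (hin (hb (x 0).val (x 1).val).1).2)
    (fun x => by
      rw [hPX]
      exact coe_circleExp_mem_slitPlane (hin (hb (x 0).val (x 1).val).2).1
        (hin (hb (x 0).val (x 1).val).2).2)
    (by rw [hQX, hQU]; exact one_ne_zero)
  rw [hSU, hSX, max_self] at h1
  exact (min_le_right _ _).trans h1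

end LineWitness

/-! ## §3 The value of the line height for every `L ≥ 4` and the fixed-volume sharp rate -/

section LineValue

omit [NeZero L] in
/-- The conjectured value for the line is non-negative (`2 ≤ L`). [folklore] -/
theorem lineSharpValue_nonneg_two (hL : 2 ≤ L) :
    0 ≤ (L : ℝ) * (1 - Real.cos (π / L)) +
        ((L : ℝ) ^ 2 - L) * (1 - Real.cos (π / ((L : ℝ) ^ 2 - L))) := by
  have hL' : (2 : ℝ) ≤ L := by exact_mod_cast hL
  exact add_nonneg (mul_nonneg (by linarith) (sub_nonneg.mpr (Real.cos_le_one _)))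
    (mul_nonneg (by nlinarith) (sub_nonneg.mpr (Real.cos_le_one _)))

/-- **The line height is finite at every volume** (`2 ≤ L`). [folklore] -/
theorem lineHeight_ne_top_two (hL : 2 ≤ L) : insHeight₂ (sliceTwist L) (0 : Site 2 L) 0 1 ≠ ⊤ :=
  ne_top_of_le_ne_top ENNReal.ofReal_ne_top (lineHeight_le_sharp_ennreal_two hL)

/-- **THE FLOOR FOR THE LINE, `4 ≤ L`**: `E*_line(L) ≤ H_line(L)` (every parity). [folklore] -/
theorem lineHeight_ge_sharp_four (hL : 4 ≤ L) :
    (L : ℝ) * (1 - Real.cos (π / L)) +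
        ((L : ℝ) ^ 2 - L) * (1 - Real.cos (π / ((L : ℝ) ^ 2 - L))) ≤
      (insHeight₂ (sliceTwist L) (0 : Site 2 L) 0 1).toReal := by
  refine (ENNReal.ofReal_le_iff_le_toReal (lineHeight_ne_top_two (by omega))).mp ?_
  rw [← insHeight₂_inv]
  exact le_insHeight₂_of_forall _ _ _ _ fun U hU => lineSharpValue_le_max_wilsonAction_four hL U hU

/-- **THE VALUE OF THE LINE HEIGHT AT EVERY VOLUME `L ≥ 4`** (conjecture C9″c as stated):
`H_line(L) = L(1 − cos(π/L)) + (L² − L)(1 − cos(π/(L² − L)))`. [folklore] -/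
theorem lineHeight_eq_sharp_four (hL : 4 ≤ L) :
    (insHeight₂ (sliceTwist L) (0 : Site 2 L) 0 1).toReal =
      (L : ℝ) * (1 - Real.cos (π / L)) +
        ((L : ℝ) ^ 2 - L) * (1 - Real.cos (π / ((L : ℝ) ^ 2 - L))) :=
  le_antisymm (ENNReal.toReal_le_of_le_ofReal (lineSharpValue_nonneg_two (by omega))
    (lineHeight_le_sharp_ennreal_two (by omega))) (lineHeight_ge_sharp_four hL)

/-- **The value at `L = 4`** (the volume not covered by `lineHeight_eq_sharp`):
`H_line(4) = 4(1 − cos(π/4)) + 12(1 − cos(π/12)) = 4 − 2√2 + 12(1 − cos(π/12))` (`≈ 1.5805`).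
[folklore] -/
theorem lineHeight_eq_sharp_at_four :
    (insHeight₂ (sliceTwist 4) (0 : Site 2 4) 0 1).toReal =
      4 - 2 * √2 + 12 * (1 - Real.cos (π / 12)) := by
  rw [lineHeight_eq_sharp_four (L := 4) le_rfl]
  have e : ((4 : ℕ) : ℝ) ^ 2 - (4 : ℕ) = 12 := by norm_num
  rw [e, show ((4 : ℕ) : ℝ) = 4 by norm_num, Real.cos_pi_div_four]
  ring

/-- **The line height is `O(1/L)` for every `L ≥ 4`**: `H_line(L) ≤ π²/L`. [folklore] -/
theorem lineHeight_le_pi_sq_div_four (hL : 4 ≤ L) :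
    (insHeight₂ (sliceTwist L) (0 : Site 2 L) 0 1).toReal ≤ π ^ 2 / L := by
  rw [lineHeight_eq_sharp_four hL]
  have hL' : (4 : ℝ) ≤ L := by exact_mod_cast hL
  set m : ℝ := (L : ℝ) ^ 2 - L with hm
  have hmL : (L : ℝ) ≤ m := by rw [hm]; nlinarith
  have hm0 : 0 < m := by linarith
  have h1 : (L : ℝ) * (1 - Real.cos (π / L)) ≤ π ^ 2 / (2 * L) := by
    have hc : 1 - (π / L) ^ 2 / 2 ≤ Real.cos (π / L) := Real.one_sub_sq_div_two_le_cos
    have e : (L : ℝ) * ((π / L) ^ 2 / 2) = π ^ 2 / (2 * L) := by field_simp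
    calc (L : ℝ) * (1 - Real.cos (π / L)) ≤ L * ((π / L) ^ 2 / 2) :=
          mul_le_mul_of_nonneg_left (by linarith) (by linarith)
      _ = π ^ 2 / (2 * L) := e
  have h2 : m * (1 - Real.cos (π / m)) ≤ π ^ 2 / (2 * L) := by
    have hc : 1 - (π / m) ^ 2 / 2 ≤ Real.cos (π / m) := Real.one_sub_sq_div_two_le_cos
    have e : m * ((π / m) ^ 2 / 2) = π ^ 2 / (2 * m) := by field_simp
    calc m * (1 - Real.cos (π / m)) ≤ m * ((π / m) ^ 2 / 2) :=
          mul_le_mul_of_nonneg_left (by linarith) (by linarith)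
      _ = π ^ 2 / (2 * m) := e
      _ ≤ π ^ 2 / (2 * L) := div_le_div_of_nonneg_left (by positivity) (by positivity) (by linarith)
  have e3 : π ^ 2 / (2 * (L : ℝ)) + π ^ 2 / (2 * L) = π ^ 2 / L := by field_simp; ring
  linarith [h1, h2, e3]

/-- **THE FIXED-VOLUME SHARP RATE OF THE LINE KERNEL AT EVERY VOLUME `L ≥ 4`** (conjecture C9″c as
stated, every parity): for every `ε > 0`, eventually in `β`,
`e^{−β(E*_line + ε)} ≤ (μ_β ⊗ K_line){Q ≠ Q'} ≤ e^{−β(E*_line − ε)}` with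
`E*_line = L(1 − cos(π/L)) + (L² − L)(1 − cos(π/(L² − L)))`. [folklore] -/
theorem u1_lineInsertion_fixedVolume_rate_four (hL : 4 ≤ L) {ε : ℝ} (hε : 0 < ε) :
    ∀ᶠ β : ℝ in atTop,
      Real.exp (-(β * ((L : ℝ) * (1 - Real.cos (π / L)) +
          ((L : ℝ) ^ 2 - L) * (1 - Real.cos (π / ((L : ℝ) ^ 2 - L))) + ε))) ≤
        ((wilsonMeasure (d := 2) (L := L) u1Rep β) ⊗ₘ lineInsertionMH (L := L) β).real
          {q | topCharge (0 : Site 2 L) 0 1 q.1 ≠ topCharge (0 : Site 2 L) 0 1 q.2} ∧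
      ((wilsonMeasure (d := 2) (L := L) u1Rep β) ⊗ₘ lineInsertionMH (L := L) β).real
          {q | topCharge (0 : Site 2 L) 0 1 q.1 ≠ topCharge (0 : Site 2 L) 0 1 q.2} ≤
        Real.exp (-(β * ((L : ℝ) * (1 - Real.cos (π / L)) +
          ((L : ℝ) ^ 2 - L) * (1 - Real.cos (π / ((L : ℝ) ^ 2 - L))) - ε))) := by
  simp only [lineInsertion_real_eq, ← lineHeight_eq_sharp_four hL]
  exact insertion_height_law (sliceTwist L) (0 : Site 2 L) 0 1 (lineHeight_ne_top_two (by omega)) hε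

end LineValue

end Summit.Ventures.LatticeQCDFlow.Theory2.Lattice.Flux

end
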